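import Literature.MathematicalPhysics.QuantumFieldTheory.Balaban1983to89.B9Eq310TwistedBondDeltaPrimeZd
import Literature.MathematicalPhysics.QuantumFieldTheory.Balaban1983to89.B9Eq335CollarBlindCubeZd
import Literature.MathematicalPhysics.QuantumFieldTheory.Balaban1983to89.B9Eq326GaugeTermSquareZd
import Literature.MathematicalPhysics.QuantumFieldTheory.Balaban1983to89.B9SupplySockB9P3ZdAllLettersZd

/-!
# `Balaban1983to89.B9Thm311IndefiniteInFrameClassCubeZd` — [Balaban1985BackgroundPropagators] Thm 3.11 p. 416 vs. (3.35) p. 396 AT A CUBE MEMBER OF THE `ℤᵈ` FRAME: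
# THE SIGN HALF OF dag-n06-b's LOCATED-SELF-7, KERNEL — inside the frame class (3.35) of every `cubeFam false` member there is a unitary background at which
# the genuine four-letter `Δ_a(U₀) = D*D + Δ′(U₀) + D R(U₀) 𝟙 D* + Q*aQ(U₀)` of the junction (`opsAllZd`) is INDEFINITE on `E_𝔤(□₀)`; hence the frame-keyed
# Theorem 3.11 positivity binder `PosDefInClassAtH … (bgZd …) … (withGopZdH (opsAllZd …))` is FALSE at cube members (the datum-keyed typing is the repair)

statement-level skeleton of published theorems with citation tags; proofs where landed; nothing here is a claim about the
Yang–Mills mass gap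

`[Balaban1985BackgroundPropagators]` ("B9", CMP **99** (1985) 389–434; journal page = PDF page + 388): Thm 3.11 p. 416 «Let us assume that U satisfies the
condition (3.35). Then the operators Δ′_a, G′, (Q′G′²Q′*)⁻¹, Δ_a, G are positive definite»; (3.35) p. 396 (the regularity class: on each cube `□ ⊂ Bʲ(Λ_j) ∪
B^{j+1}(Λ_{j+1})` a gauge with `U^u = e^{iηA}`, `|A|, |∇A|` small); (3.26) p. 395 «Δ_a = Δ + DRD* + Q*aQ»; (3.10) p. 392; (3.16) p. 393; (3.20)–(3.22) p. 394;
(3.27) p. 395.  `[Balaban1985RegularSpaces]` ("B8", CMP **99** (1985) 75–102): (1.7) p. 77 (the class `𝔄_m({Ω_j}, α₀)`, plaquettes TOUCHING `Ω_j`), (1.33)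
p. 82, (1.131) p. 99, (1.38) p. 82.  PDF held: `paper:balaban1985-cmp99-background-propagators` pp. 392–396, 416.

CITATION HEADER ∕ WHY THIS FILE (cell `pub-ymgap`, HUMAN RULING D-0062 ∕ D-0149; width seat `pub-ymgap-dag-n06-w3` (g5), node N06 = [B9]; CLAIM-1 file 3∕3;
count-neutral).  dag-n06-b g20 (letter∕binder owner of the junction J-N06→N05) LOCATED (bus, LOCATED-SELF-7 and its COROLLARY) that every FRAME-keyed
statement about the genuine `G_𝔤 ∕ Δ_a` over the class (3.35) of the `ℤᵈ` frame is uninhabitable at `cubeFam false` members, certified the PREMISE in kernel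
(`B9Eq335CollarBlindCubeZd`, p627199: the class is blind to the collar of `□₀` and switches the genuine `Q*aQ` off at a background with a plaquette `−1`
touching `□₀`), and left the SIGN computation «typable from `B9Eq310Hermitian`'s second-variation identities if a referee wants it» (■ I.36498, «OPEN for a
successor»).  THIS file closes it: at the CROSSING-BOND TWIST (`U₀ = −1` on the one bond `b = ⟨x₀ − e₁, x₀⟩` into the lower corner `x₀` of `□₀`, `= 1` elsewhere;
based outside `□₀`, so `u = 1`, `A = 0` exhibit (3.35) on every class cube — §1, the collar mechanism in general form) the form of the genuine `Δ_a(U₀)` on the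
Hermitian single-bond field `δ_b·h` is, letter by letter (files 1–2 + dag-n06-w4 g0's Bessel bound for the constructed projection `R(U₀)`):
`2(d−1)η⁻²|h|²_τ` (D*D) `− 4(d−1)η⁻²|h|²_τ` (Δ′: weight `Re U(∂p) − 1 = −2` on the `2(d−1)` plaquettes through `b`) `+ (≤ η⁻²|h|²_τ)` (D R 𝟙 D*: ONE inner end-point)
`+ 0` (Q*aQ: guard (1.7) off), `≤ (1 − 2(d−1))η⁻²|h|²_τ < 0` for `d ≥ 2`.  CONSEQUENCE (n06-b's COROLLARY, now kernel): the junction's frame-keyed Thm 3.11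
binders `PosDefInClassAtH ∕ PosDefInClassAt` are FALSE for the genuine record at cube members — print's theorem is about `U` regular on cubes COVERING the
plaquettes `Δ_a↾Ω₀` reads; the frame's class at a cube member does not cover the collar.  The inhabitable typing is the DATUM-keyed one ([B8] (1.33)
`U₀ ∈ 𝔄_m({□_j}, α₀)`: dag-n06-b's EDITION U ∕ `InvAtHI`, this lineage's g4 `B9Thm311TouchingClassOfCoerciveZd.posDefH_regularAtH_of_inAk_of_coercive`).

WHAT IS PROVED (kernel, 0 sorry; theorems only — no `def`, `instance`, `notation`).
* §1 ★ `reg335_bgZd_of_one_on_omega` — COLLAR BLINDNESS, GENERAL FORM: at ANY member (`1 ≤ L`), every unitary `U₀ ≡ 1` on the bonds based in `Ω₀` lies in the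
  frame class `(bgZd …).Reg335 c35 α₀` for every `c35·M·α₀ > 0` (p627199's proof, the background abstracted).
* §2 `re_tau_star_smul_mul_smul ∕ re_tau_star_mul_smul` (real scalars through `Re τ`), ★ `DRD_twist_form_le` (`⟨δ_b h, D R(U₀) 𝟙_s D* δ_b h⟩_τ ≤ η⁻²·Re τ(h*h)`
  for every finite `s ∌ z`: `B9Eq326GaugeTermSquareZd.finsum_re_trace_bond_DRD_le_div_sq` + file 1's divergence), ★ `not_reg17_twist` (the twist violates (1.7)
  of any `{Ω_j}` with `z + e_ν ∈ Ω₀`, every `α ≤ 2`), ★ `QQZdP_twist_eq_zero` (the genuine `Q*aQ` of EDITION P vanishes identically there, `L ≥ 1`).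
* §3 (any member with finite `Ω₀ ∌ z`, `z + e_ν ∈ Ω₀`, faithful Hermitian tracial `τ`, `L ≥ 1`, a direction `κ ≠ ν`) ★★★ `bondPair_deltaAOf_opsAllZd_twist_le`
  (`⟨δ_b h, Δ_a(U₀)δ_b h⟩_τ ≤ (1 − 2(d−1))·η⁻²·Re τ(h*h)`), ★★★ `bondPair_deltaAOf_opsAllZd_twist_neg` (`< 0` for `h ≠ 0`, `d ≥ 2`).
* §4 (cube members `Ω = cubeFam false L a Mc ρ k`, `2 ≤ d`, `1 ≤ L`, `1 ≤ ρ`; `𝔸 : Type`) ★★★ `exists_reg335_bondPair_deltaAOf_neg_cube` (for every `c35·M·α₀ > 0`: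
  a unitary `U₀` IN the frame class and a Hermitian `0 ≠ A ∈ E_𝔤(□₀)` with `⟨A, Δ_a(U₀)A⟩_τ < 0`), ★★★ `not_posDefInClassAtH_opsAllZd_cube`
  (`¬ PosDefInClassAtH τ (bgZd 𝔸 L) memZd (ιCfgZd 𝔸 L) (withGopZdH (opsAllZd τ L ΛbP ops₀)) c35 a₃ M i m` for `0 < c35`, `0 < M`, `0 < a₃`),
  ★★ `not_posDefInClassAt_opsAllZd_cube` (the `E(□₀)` twin, `B9SupplySockB9P3ZdGenuineGop.PosDefInClassAt`).

HONEST SCOPE.  A located NEGATIVE about a TYPING (class MISSTATED: frame-keyed (3.35) at a cube member vs print's covering convention), with the repaired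
statement already in tree; it does NOT contradict [B9] Thm 3.11 and proves no estimate of [B9]; constants none; `d ≥ 2` (at `d = 1` there are no
plaquettes); count-neutral helper of K1⁹ (`--supports stmt-QuantumFields-27364`); N05 ∕ N06 NOT discharged; K1⁹ NOT closed; one finite `𝕋⁴` programme at fixed
`ε`, Bałaban as printed; R4 closes only the conditional finite-`𝕋⁴` rung `BalabanLadder.UV` — nothing continuum ∕ `ℝ⁴` ∕ OS ∕ mass gap ∕ Clay.  Unit
`pub-ymgap-dag-n06-w3` (g5), 2026-08-28.
-/

noncomputable section

open scoped BigOperators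
open NormedSpace

namespace Literature.MathematicalPhysics.QuantumFieldTheory.Balaban1983to89.B9Thm311IndefiniteInFrameClassCubeZd

open B7Prop1Explicit (e gaugeAct)
open B7Prop2Explicit (unitaryUnits)
open B7Eq78Linearization (conjR)
open B8Ineq132 (PlaqTouches plaqF covDeriv covDerivFwd)
open B8Eq138LandauZd (covDivB)
open B8Eq133Hypotheses (shiftT byDir byDir_apply Reg335Zd reg335Zd_iff fluct_zero)
open B8Eq131Cubes (sqLo sqHi)
open B8Eq131CubesAdmissible (cubeFam cubeFam_false_zero)
open B8Ineq159FlatCubeMemberKernel (mem_cube_zero_iff)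
open B8LeafModelZd (ZdIdx)
open B8Eq155JBound (Jcur)
open B9SupplySockB9P3ZdFrame (bgZd memZd ιCfgZd cubeClass396Zd reg335_bgZd_mem_iff memZd_i)
open B9SupplySockB9P3ZdLetters (OpsZd deltaAOf)
open B9SupplySockB9P3ZdAllLettersZd (opsAllZd)
open B9Eq316AveragingTransposeZd (Reg17 alphaQ alphaQ_pos)
open B9Eq316AveragingTransposeZdPrinted (QQZdP QQZdP_of_not_reg17)
open B9Eq335CollarBlindCubeZd (cubeClass_subset_omega_zero)
open B9Thm311PerMemberCubeZdTouching (sqLo_le_sqHi_zero)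
open B9Eq327GreenZd (domSub bondPair)
open B9Eq327GreenZdHerm (domSubH PosDefInClassAtH withGopZdH deltaAOf_withGopZdH)
open B9Eq369CurvSmallZd (DpZd)
open LatticeNorms (scaleLen scaleLen_pos)
open B9Eq310TwistedBondDstarDZd B9Eq310TwistedBondDeltaPrimeZd

export B7Prop1Explicit (Site)

variable {d : ℕ}

/-! ## §1  Collar blindness of the frame class, general form -/

section Collar

variable {𝔸 : Type} [CStarAlgebra 𝔸] [Nontrivial 𝔸] {L : ℕ}

/-- ★ **COLLAR BLINDNESS OF THE FRAME CLASS (3.35), GENERAL FORM** (dag-n06-b g20's `B9Eq335CollarBlindCubeZd.exists_reg335_plaq_neg_one_cube`, the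
mechanism stated for an ARBITRARY background and an ARBITRARY member, `1 ≤ L`): EVERY unitary `U₀` equal to `1` on the bonds BASED IN `Ω₀` lies in
the frame class `(bgZd …).Reg335 c35 α₀` for every `c35·M·α₀ > 0` — the gauge `u = 1`, `A = 0` exhibits (3.35) on every class cube, since those lie in
`Ω₀`; the collar bonds (based outside `Ω₀`, one end inside) are not read.
[cite: Balaban1985BackgroundPropagators, (3.35) p.396; Balaban1985RegularSpaces, (1.131) p.99, (1.7) p.77] -/
theorem reg335_bgZd_of_one_on_omega (hL : 1 ≤ L) (M : ℝ) (i : ZdIdx d L) (m : ℕ) {c35 α₀ : ℝ} (hc : 0 < c35 * M * α₀)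
    {U₀ : Site d → Fin d → 𝔸ˣ} (hU₀ : ∀ x κ, U₀ x κ ∈ unitaryUnits 𝔸) (hone : ∀ y ∈ i.Ω 0, ∀ κ, U₀ y κ = 1) :
    (bgZd 𝔸 L (memZd M i m)).Reg335 c35 α₀ (ιCfgZd 𝔸 L M i m U₀ hU₀) := by
  classical
  rw [reg335_bgZd_mem_iff, reg335Zd_iff]
  intro q hq
  have hq0 : q.1 ⊆ i.Ω 0 := by
    have h := cubeClass_subset_omega_zero (memZd M i m) hq
    rwa [memZd_i] at h
  have hη : 0 < i.η := i.hη
  have hLr : (0 : ℝ) < (L : ℝ) := by exact_mod_cast hL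
  have hξ : 0 < scaleLen (L : ℝ) i.η q.2 := scaleLen_pos hLr hη q.2
  refine ⟨1, 0, fun z' _ => ⟨by simp, by simp⟩, fun κ z' hz' => ?_, fun κ z' _ => ?_, fun κ ν' z' _ => ?_⟩
  · rw [fluct_zero]
    simp only [byDir_apply, gaugeAct, Pi.one_apply, one_mul, inv_one, mul_one]
    exact hone z' (hq0 hz') κ
  · simp only [Pi.zero_apply, norm_zero]
    positivity
  · have h0 : B9Eq39Adjoint.covD (shiftT d) (fun _ _ => (1 : 𝔸ˣ)) κ ((0 : Fin d → Site d → 𝔸) ν') z' = 0 := B9Eq39Adjoint.covD_zero _ _ κ z'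
    rw [h0, smul_zero, norm_zero]
    positivity

end Collar

/-! ## §2  The gauge-fixing term has one inner end-point; the averaging term is switched off -/

section Letters

variable {𝔸 : Type*} [CStarAlgebra 𝔸]
variable (z : Site d) (ν : Fin d) (h : 𝔸) (η : ℝ)
variable {U₀ : Site d → Fin d → 𝔸ˣ} (hU : ∀ y κ, U₀ y κ = if y = z ∧ κ = ν then -1 else 1)
variable {A : Site d → Fin d → 𝔸} (hA : ∀ y κ, A y κ = if y = z ∧ κ = ν then h else 0)

omit hU hA in
/-- `Re τ((r·a)*(r·a)) = r²·Re τ(a*a)` for a real scalar. [cite: Balaban1985BackgroundPropagators, p.391 (bookkeeping)] -/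
theorem re_tau_star_smul_mul_smul (τ : 𝔸 →ₗ[ℂ] ℂ) (r : ℝ) (a : 𝔸) :
    (τ (star (r • a) * (r • a))).re = r * r * (τ (star a * a)).re := by
  rw [star_smul, star_trivial, smul_mul_smul_comm, ← Complex.coe_smul, map_smul, smul_eq_mul, Complex.re_ofReal_mul]

omit hU hA in
/-- `Re τ(a*(r·b)) = r·Re τ(a*b)` for a real scalar. [cite: Balaban1985BackgroundPropagators, p.391 (bookkeeping)] -/
theorem re_tau_star_mul_smul (τ : 𝔸 →ₗ[ℂ] ℂ) (r : ℝ) (a b : 𝔸) : (τ (star a * (r • b))).re = r * (τ (star a * b)).re := by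
  rw [mul_smul_comm, ← Complex.coe_smul, map_smul, smul_eq_mul, Complex.re_ofReal_mul]

include hU hA in
/-- ★ **THE GAUGE-FIXING TERM AT THE TWISTED BOND HAS ONE INNER END-POINT**: for every finite site set `s ∌ z` (the `Ω₀` of the member) and the constructed
projection `R(U₀)` of [B9] (3.21)–(3.22), `⟨δ_b h, D^η_{U₀} R(U₀) 𝟙_s D^{η*}_{U₀} δ_b h⟩_τ ≤ ‖𝟙_s D^{η*}_{U₀}δ_b h‖²_τ ≤ η⁻²·Re τ(h*h)` (dag-n06-w4 g0's Bessel bound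
`finsum_re_trace_bond_DRD_le_div_sq`, then (c)). [cite: Balaban1985BackgroundPropagators, (3.20)–(3.22) p.394, (3.26) p.395; Balaban1985RegularSpaces, (1.38) p.82] -/
theorem DRD_twist_form_le [FiniteDimensional ℝ 𝔸] (τ : 𝔸 →ₗ[ℂ] ℂ) (hτt : ∀ a b : 𝔸, τ (a * b) = τ (b * a))
    (hτs : ∀ a : 𝔸, τ (star a) = starRingEnd ℂ (τ a)) (hτp : ∀ a : 𝔸, a ≠ 0 → 0 < (τ (star a * a)).re)
    {s : Finset (Site d)} (hz : z ∉ s) (L m : ℕ) (Λs : ℕ → Set (Site d)) :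
    ∑ μ : Fin d, ∑ᶠ x, (τ (star (A x μ) * covDerivFwd η U₀ μ (B9Eq321LandauProjectionZd.projR τ s L m η Λs U₀ (covDivB η U₀ A)) x)).re ≤
      η⁻¹ * η⁻¹ * (τ (star h * h)).re := by
  classical
  have hU' : ∀ (x : Site d) (κ : Fin d), U₀ x κ ∈ unitaryUnits 𝔸 := twist_mem_unitaryUnits z ν hU
  refine (B9Eq326GaugeTermSquareZd.finsum_re_trace_bond_DRD_le_div_sq hτt hτs hτp hU' (support_single_finite z ν h hA)).trans ?_
  have hterm : ∀ x ∈ s, (τ (star (covDivB η U₀ A x) * covDivB η U₀ A x)).re =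
      if x = z + e ν then η⁻¹ * η⁻¹ * (τ (star h * h)).re else 0 := by
    intro x hx
    have hxz : x ≠ z := fun h' => hz (h' ▸ hx)
    split_ifs with hx'
    · rw [hx', covDivB_single_far z ν h η hU hA, re_tau_star_smul_mul_smul]
    · rw [covDivB_single_of_ne z ν h η hA hxz hx', star_zero, zero_mul, map_zero, Complex.zero_re]
  rw [Finset.sum_congr rfl hterm, Finset.sum_ite_eq']
  have hnn : 0 ≤ η⁻¹ * η⁻¹ * (τ (star h * h)).re := by
    have h1 : 0 ≤ η⁻¹ * η⁻¹ := mul_self_nonneg _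
    have h2 : 0 ≤ (τ (star h * h)).re := by
      by_cases hh : h = 0
      · rw [hh, mul_zero, map_zero, Complex.zero_re]
      · exact (hτp h hh).le
    exact mul_nonneg h1 h2
  split_ifs
  · exact le_rfl
  · exact hnn


/-! ### `Q*aQ`: the (1.7) guard is off at the twisted background -/

omit hA in
include hU in
/-- ★ the twisted background violates print's class (1.7) of ANY domain sequence whose `Ω₀` contains the far end of the crossing bond, at every threshold
`α ≤ 2` (the plaquette `p_{κν}(z)`, `κ ≠ ν`, touches `Ω₀` and has `‖U₀(∂p) − 1‖ = 2`). [cite: Balaban1985RegularSpaces, (1.7) p.77; Balaban1985BackgroundPropagators, (3.16) p.393] -/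
theorem not_reg17_twist [Nontrivial 𝔸] {L m : ℕ} {Ω : ℕ → Set (Site d)} (hx₀ : z + e ν ∈ Ω 0) {κ : Fin d} (hκ : κ ≠ ν) {α : ℝ} (hα : α ≤ 2) :
    ¬ Reg17 L m Ω α U₀ := by
  intro h17
  have h1 := h17 0 (Nat.zero_le m) z κ ν hκ (Or.inr (Or.inr (Or.inl hx₀)))
  rw [plaqF_twist_at z ν hU hκ, pow_zero, inv_one, one_pow, mul_one] at h1
  have h2 : ‖(-1 : 𝔸) - 1‖ = 2 := by
    have h : (-1 : 𝔸) - 1 = -((2 : ℝ) • (1 : 𝔸)) := by rw [two_smul]; abel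
    rw [h, norm_neg, norm_smul, norm_one, mul_one, Real.norm_eq_abs, abs_of_pos (by norm_num : (0 : ℝ) < 2)]
  linarith

omit hA in
include hU in
/-- ★ hence the genuine averaging letter `Q*aQ(U₀)` of EDITION P (`QQZdP`, guarded by (1.7) at the window `α_Q∕L²`) VANISHES IDENTICALLY at the twisted
background, for every member whose `Ω₀` contains the far end of the crossing bond (`L ≥ 1`, `d ≥ 2`). [cite: Balaban1985BackgroundPropagators, (3.16) p.393; Balaban1985RegularSpaces, (1.7) p.77] -/
theorem QQZdP_twist_eq_zero [Nontrivial 𝔸] [FiniteDimensional ℝ 𝔸] (τ : 𝔸 →ₗ[ℂ] ℂ) {L : ℕ} (hL : 1 ≤ L) (ΛbP : ℕ → ℕ → Set (Site d × Fin d))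
    (i : ZdIdx d L) (m : ℕ) (hx₀ : z + e ν ∈ i.Ω 0) {κ : Fin d} (hκ : κ ≠ ν) (B : Site d → Fin d → 𝔸) (y : Site d) (μ : Fin d) :
    QQZdP τ L ΛbP i m U₀ B y μ = 0 := by
  have hLr : (1 : ℝ) ≤ L := by exact_mod_cast hL
  have hwin : alphaQ d L / (L : ℝ) ^ 2 ≤ 2 := by
    have h1 : alphaQ d L ≤ 1 := B9Thm311SmallFieldPathZdContinuity.alphaQ_le_one d hL
    have h2 : (1 : ℝ) ≤ (L : ℝ) ^ 2 := one_le_pow₀ hLr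
    have h3 : alphaQ d L / (L : ℝ) ^ 2 ≤ alphaQ d L := div_le_self (alphaQ_pos d hL).le h2
    linarith
  exact QQZdP_of_not_reg17 τ L (not_reg17_twist z ν hU hx₀ hκ hwin) B y μ

end Letters

/-! ## §3  The form of the genuine four-letter `Δ_a(U₀)` on the test field is NEGATIVE -/

section Form

variable {𝔸 : Type*} [CStarAlgebra 𝔸] [Nontrivial 𝔸] [FiniteDimensional ℝ 𝔸]
variable (τ : 𝔸 →ₗ[ℂ] ℂ) (hτt : ∀ a b : 𝔸, τ (a * b) = τ (b * a)) (hτs : ∀ a : 𝔸, τ (star a) = starRingEnd ℂ (τ a))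
  (hτp : ∀ a : 𝔸, a ≠ 0 → 0 < (τ (star a * a)).re)
variable {L : ℕ} (ΛbP : ℕ → ℕ → Set (Site d × Fin d)) (ops₀ : ℝ → ZdIdx d L → ℕ → OpsZd d 𝔸) (M : ℝ) (i : ZdIdx d L) (m : ℕ)
variable (z : Site d) (ν : Fin d) (h : 𝔸)
variable {U₀ : Site d → Fin d → 𝔸ˣ} (hU : ∀ y κ, U₀ y κ = if y = z ∧ κ = ν then -1 else 1)
variable {A : Site d → Fin d → 𝔸} (hA : ∀ y κ, A y κ = if y = z ∧ κ = ν then h else 0)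

include hτt hτs hτp hU hA in
/-- ★★★ **THE FORM OF THE GENUINE `Δ_a(U₀)` AT THE TWIST IS BOUNDED BY A NEGATIVE MULTIPLE OF `|h|²_τ`**: at a member with finite `Ω₀` whose `Ω₀` contains the
far end `z + e_ν` of the crossing bond but not its base `z` (`1 ≤ L`, some direction `κ ≠ ν`), for the four-letter record `opsAllZd` (D*D + Δ′ + D R 𝟙 D* +
Q*aQ of this lineage): `⟨δ_b h, Δ_a(U₀) δ_b h⟩_τ ≤ (1 − 2(d−1))·η⁻²·Re τ(h*h)` — letter by letter `2(d−1)η⁻²|h|² − 4(d−1)η⁻²|h|² + (≤ η⁻²|h|²) + 0`.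
[cite: Balaban1985BackgroundPropagators, (3.26) p.395, (3.10) p.392, Thm 3.11 p.416; Balaban1985RegularSpaces, (1.7) p.77] -/
theorem bondPair_deltaAOf_opsAllZd_twist_le (hL : 1 ≤ L) (hΩ : (i.Ω 0).Finite) (hz : z ∉ i.Ω 0) (hx₀ : z + e ν ∈ i.Ω 0)
    {κ : Fin d} (hκ : κ ≠ ν) :
    bondPair τ A (deltaAOf i.η (opsAllZd τ L ΛbP ops₀ M i m) U₀ A) ≤
      (1 - 2 * ((d - 1 : ℕ) : ℝ)) * (i.η⁻¹ * i.η⁻¹ * (τ (star h * h)).re) := by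
  classical
  have hz' : z ∉ hΩ.toFinset := fun h' => hz (hΩ.mem_toFinset.mp h')
  -- the DRD* letter, paired
  have hDRD : (τ (star h * (opsAllZd τ L ΛbP ops₀ M i m).DRDs U₀ A z ν)).re ≤ i.η⁻¹ * i.η⁻¹ * (τ (star h * h)).re := by
    have heq : (τ (star h * (opsAllZd τ L ΛbP ops₀ M i m).DRDs U₀ A z ν)).re =
        bondPair τ A (fun x μ => (opsAllZd τ L ΛbP ops₀ M i m).DRDs U₀ A x μ) := (bondPair_single_left z ν h τ hA _).symm
    rw [heq, bondPair]
    simp only [B9SupplySockB9P3ZdAllLettersZd.opsAllZd_DRDs, B9Eq321LandauProjectionZd.opsLandau_DRDs_of_finite τ _ M i m hΩ]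
    exact DRD_twist_form_le z ν h i.η hU hA τ hτt hτs hτp hz' L m (i.Λs m)
  -- the pairing reads the bond `b` only; unfold the four letters there
  rw [bondPair_single_left z ν h τ hA]
  have hsplit : deltaAOf i.η (opsAllZd τ L ΛbP ops₀ M i m) U₀ A z ν =
      Jcur i.η U₀ A ν z + DpZd i.η U₀ A z ν + (opsAllZd τ L ΛbP ops₀ M i m).DRDs U₀ A z ν + QQZdP τ L ΛbP i m U₀ A z ν := rfl
  rw [hsplit, Jcur_twist_single z ν h i.η hU hA, DpZd_twist_single z ν h i.η hU hA, QQZdP_twist_eq_zero z ν hU τ hL ΛbP i m hx₀ hκ A z ν,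
    add_zero, mul_add, mul_add, map_add, map_add, Complex.add_re, Complex.add_re, re_tau_star_mul_smul, re_tau_star_mul_smul,
    re_tau_star_mul_smul, re_tau_star_mul_smul]
  nlinarith [hDRD]

include hτt hτs hτp hU hA in
/-- ★★★ **… HENCE NEGATIVE** for `h ≠ 0` and `d ≥ 2`: `⟨δ_b h, Δ_a(U₀) δ_b h⟩_τ < 0` — the genuine four-letter `Δ_a(U₀)` is NOT positive (semi-)definite on
`E(Ω₀)` at the twisted background. [cite: Balaban1985BackgroundPropagators, Thm 3.11 p.416, (3.26) p.395, (3.10) p.392] -/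
theorem bondPair_deltaAOf_opsAllZd_twist_neg (hd2 : 2 ≤ d) (hL : 1 ≤ L) (hΩ : (i.Ω 0).Finite) (hz : z ∉ i.Ω 0) (hx₀ : z + e ν ∈ i.Ω 0)
    {κ : Fin d} (hκ : κ ≠ ν) (hh : h ≠ 0) :
    bondPair τ A (deltaAOf i.η (opsAllZd τ L ΛbP ops₀ M i m) U₀ A) < 0 := by
  refine (bondPair_deltaAOf_opsAllZd_twist_le τ hτt hτs hτp ΛbP ops₀ M i m z ν h hU hA hL hΩ hz hx₀ hκ).trans_lt ?_
  have hρ : 0 < (τ (star h * h)).re := hτp h hh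
  have hη : 0 < i.η⁻¹ * i.η⁻¹ := by have := i.hη; positivity
  have hd' : (1 : ℝ) - 2 * ((d - 1 : ℕ) : ℝ) < 0 := by
    have : (1 : ℝ) ≤ ((d - 1 : ℕ) : ℝ) := by exact_mod_cast (show 1 ≤ d - 1 by omega)
    linarith
  exact mul_neg_of_neg_of_pos hd' (mul_pos hη hρ)

end Form

/-! ## §4  At a cube member: the frame class holds a background where the genuine `Δ_a` is indefinite — `¬ PosDefInClassAtH` -/

section Cube

variable {𝔸 : Type} [CStarAlgebra 𝔸] [Nontrivial 𝔸] [FiniteDimensional ℝ 𝔸]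
variable (τ : 𝔸 →ₗ[ℂ] ℂ) (hτt : ∀ a b : 𝔸, τ (a * b) = τ (b * a)) (hτs : ∀ a : 𝔸, τ (star a) = starRingEnd ℂ (τ a))
  (hτp : ∀ a : 𝔸, a ≠ 0 → 0 < (τ (star a * a)).re)
variable {L : ℕ} (ΛbP : ℕ → ℕ → Set (Site d × Fin d)) (ops₀ : ℝ → ZdIdx d L → ℕ → OpsZd d 𝔸)

include hτt hτs hτp in
/-- ★★★ **INSIDE THE FRAME CLASS (3.35) OF A CUBE MEMBER THE GENUINE `Δ_a(U₀)` IS INDEFINITE ON `E_𝔤(□₀)`** (the SIGN half of dag-n06-b g20's LOCATED-SELF-7,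
kernel): at every `cubeFam false` member (`2 ≤ d`, `1 ≤ L`, `1 ≤ ρ`), for every frame constant `c35·M·α₀ > 0`, there are a unitary `U₀` IN the class
`(bgZd …).Reg335 c35 α₀` (the crossing-bond twist at the lower corner of `□₀`; gauge `u = 1`, `A = 0` on every class cube) and a Hermitian `0 ≠ A ∈ E_𝔤(□₀)` (the
bond field `δ_b·1`) with `⟨A, Δ_a(U₀)A⟩_τ < 0` for the genuine four-letter record `opsAllZd`.  Print's Thm 3.11 asserts positivity for `U` «satisfying (3.35)»
on the cubes COVERING `Ω₀`'s plaquettes; the frame's class at a cube member does not cover the collar plaquettes that `Δ_a↾E(□₀)` reads — the typing, not the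
theorem, is at fault (repaired, inhabitable typing: the datum-keyed class `𝔄_m({□_j}, α₀)` of [B8] (1.33), this lineage's `…TouchingClassOfCoerciveZd` ∕ n06-b's
EDITION U). [cite: Balaban1985BackgroundPropagators, Thm 3.11 p.416, (3.35) p.396, (3.26) p.395, (3.10) p.392; Balaban1985RegularSpaces, (1.7) p.77, (1.33) p.82, (1.131) p.99] -/
theorem exists_reg335_bondPair_deltaAOf_neg_cube (hd2 : 2 ≤ d) (hL : 1 ≤ L) (M : ℝ) (i : ZdIdx d L)
    {a : Site d} {Mc ρ : ℕ} (hρ : 1 ≤ ρ) (hΩ : i.Ω = cubeFam false L a Mc ρ i.k) (m : ℕ) {c35 α₀ : ℝ} (hc : 0 < c35 * M * α₀) :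
    ∃ (U₀ : Site d → Fin d → 𝔸ˣ) (hU₀ : ∀ x κ, U₀ x κ ∈ unitaryUnits 𝔸),
      (bgZd 𝔸 L (memZd M i m)).Reg335 c35 α₀ (ιCfgZd 𝔸 L M i m U₀ hU₀) ∧
        ∃ A ∈ domSubH (𝔸 := 𝔸) (i.Ω 0), A ≠ 0 ∧ bondPair τ A (deltaAOf i.η (opsAllZd τ L ΛbP ops₀ M i m) U₀ A) < 0 := by
  classical
  -- two directions: the crossing direction `ν = e₁` and a transverse one `κ = e₀`
  obtain ⟨κ, ν, hκν⟩ : ∃ κ ν : Fin d, κ ≠ ν := ⟨⟨0, by omega⟩, ⟨1, by omega⟩, by simp [Fin.ext_iff]⟩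
  -- the lower corner `x₀` of `□₀` and the site `z = x₀ − e_ν` just outside
  obtain ⟨x₀, hx₀_def⟩ : ∃ x₀ : Site d, x₀ = sqLo L a ρ i.k 0 := ⟨_, rfl⟩
  have hx₀ : x₀ ∈ i.Ω 0 := by
    rw [hΩ, cubeFam_false_zero, mem_cube_zero_iff, hx₀_def]
    exact fun i' => ⟨le_rfl, sqLo_le_sqHi_zero L a Mc hρ i.k i'⟩
  obtain ⟨z, hz_def⟩ : ∃ z : Site d, z = x₀ - e ν := ⟨_, rfl⟩
  have hz : z ∉ i.Ω 0 := by
    rw [hΩ, cubeFam_false_zero, mem_cube_zero_iff]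
    intro h
    have h1 := (h ν).1
    rw [hz_def, Pi.sub_apply, B7Prop1Explicit.e_apply, if_pos rfl, hx₀_def] at h1
    linarith
  have hzx : z + e ν = x₀ := by rw [hz_def, sub_add_cancel]
  have hfin : (i.Ω 0).Finite := B9Thm311PosDefOpenZd.cubeMember_Ω0_finite i hΩ
  -- the twist and the test field
  obtain ⟨U₀, hU⟩ : ∃ U₀ : Site d → Fin d → 𝔸ˣ, ∀ y κ', U₀ y κ' = if y = z ∧ κ' = ν then -1 else 1 := ⟨fun y κ' => if y = z ∧ κ' = ν then -1 else 1, fun _ _ => rfl⟩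
  obtain ⟨A, hA⟩ : ∃ A : Site d → Fin d → 𝔸, ∀ y κ', A y κ' = if y = z ∧ κ' = ν then (1 : 𝔸) else 0 := ⟨fun y κ' => if y = z ∧ κ' = ν then 1 else 0, fun _ _ => rfl⟩
  have hU₀ : ∀ x κ', U₀ x κ' ∈ unitaryUnits 𝔸 := twist_mem_unitaryUnits z ν hU
  refine ⟨U₀, hU₀, ?_, A, single_mem_domSubH z ν 1 (hzx ▸ hx₀) (IsSelfAdjoint.one 𝔸) hA, single_ne_zero z ν 1 one_ne_zero hA, ?_⟩
  · -- in the frame class: `U₀ ≡ 1` on the bonds based in `□₀` (collar blindness)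
    exact reg335_bgZd_of_one_on_omega hL M i m hc hU₀ fun y hy κ' => twist_of_site_ne z ν hU (fun h' => hz (h' ▸ hy)) κ'
  · exact bondPair_deltaAOf_opsAllZd_twist_neg τ hτt hτs hτp ΛbP ops₀ M i m z ν 1 hU hA hd2 hL hfin hz (hzx ▸ hx₀) hκν one_ne_zero

include hτt hτs hτp in
/-- ★★★ **THE FRAME-KEYED THEOREM 3.11 POSITIVITY BINDER IS FALSE FOR THE GENUINE RECORD AT EVERY CUBE MEMBER**: for `0 < c35`, `0 < M`, `0 < a₃` (so that the
binder's guards `0 < α₀`, `M·α₀ ≤ a₃` are met by `α₀ = a₃∕M`), `¬ PosDefInClassAtH τ (bgZd 𝔸 L) memZd (ιCfgZd 𝔸 L) (withGopZdH (opsAllZd τ L ΛbP ops₀)) c35 a₃ M i m`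
— the `Prop` displayed by the junction's frame-keyed knits («for U satisfying (3.35) … Δ_a positive definite», keyed to the frame class) is UNINHABITABLE at
`cubeFam false` members; the datum-keyed statements (n06-b `InvAtHI` ∕ EDITION U, this lineage's `posDefH_regularAtH_of_inAk_of_coercive`) are the repair.
[cite: Balaban1985BackgroundPropagators, Thm 3.11 p.416, (3.35) p.396, (3.27) p.395; Balaban1985RegularSpaces, (1.33) p.82, (1.131) p.99] -/
theorem not_posDefInClassAtH_opsAllZd_cube (hd2 : 2 ≤ d) (hL : 1 ≤ L) {M : ℝ} (hM : 0 < M) (i : ZdIdx d L)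
    {a : Site d} {Mc ρ : ℕ} (hρ : 1 ≤ ρ) (hΩ : i.Ω = cubeFam false L a Mc ρ i.k) (m : ℕ) {c35 a₃ : ℝ} (hc35 : 0 < c35) (ha₃ : 0 < a₃) :
    ¬ PosDefInClassAtH τ (bgZd 𝔸 L) memZd (ιCfgZd 𝔸 L) (withGopZdH (opsAllZd τ L ΛbP ops₀)) c35 a₃ M i m := by
  intro hpos
  have hα : 0 < a₃ / M := div_pos ha₃ hM
  have hMα : M * (a₃ / M) ≤ a₃ := by rw [mul_div_cancel₀ _ hM.ne']
  have hc : 0 < c35 * M * (a₃ / M) := by rw [mul_assoc, mul_div_cancel₀ _ hM.ne']; exact mul_pos hc35 ha₃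
  obtain ⟨U₀, hU₀, hreg, A, hA, hA0, hneg⟩ :=
    exists_reg335_bondPair_deltaAOf_neg_cube τ hτt hτs hτp ΛbP ops₀ hd2 hL M i hρ hΩ m hc
  have hcon := hpos (a₃ / M) U₀ hU₀ hα hMα hreg A hA hA0
  rw [deltaAOf_withGopZdH] at hcon
  linarith

include hτt hτs hτp in
/-- ★★ the same for the binder on all of `E(□₀)` (`B9SupplySockB9P3ZdGenuineGop.PosDefInClassAt`, Hermitian or not): FALSE at every cube member.  (dag-n06-b g18's
`B9SupplySockB9P3ZdSkewGaugeMode.not_posDefInClassAt_opsAllZd` already refutes this `𝔸`-valued binder by a SKEW pure-gauge zero mode at the flat background, at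
members whose class misses two sites of one block; the witness here is Hermitian, lives in the collar, and needs only `d ≥ 2`.)
[cite: Balaban1985BackgroundPropagators, Thm 3.11 p.416, (3.35) p.396, (3.26) p.395] -/
theorem not_posDefInClassAt_opsAllZd_cube (hd2 : 2 ≤ d) (hL : 1 ≤ L) {M : ℝ} (hM : 0 < M) (i : ZdIdx d L)
    {a : Site d} {Mc ρ : ℕ} (hρ : 1 ≤ ρ) (hΩ : i.Ω = cubeFam false L a Mc ρ i.k) (m : ℕ) {c35 a₃ : ℝ} (hc35 : 0 < c35) (ha₃ : 0 < a₃) :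
    ¬ B9SupplySockB9P3ZdGenuineGop.PosDefInClassAt τ (bgZd 𝔸 L) memZd (ιCfgZd 𝔸 L) (withGopZdH (opsAllZd τ L ΛbP ops₀)) c35 a₃ M i m := by
  intro hpos
  have hα : 0 < a₃ / M := div_pos ha₃ hM
  have hMα : M * (a₃ / M) ≤ a₃ := by rw [mul_div_cancel₀ _ hM.ne']
  have hc : 0 < c35 * M * (a₃ / M) := by rw [mul_assoc, mul_div_cancel₀ _ hM.ne']; exact mul_pos hc35 ha₃
  obtain ⟨U₀, hU₀, hreg, A, hA, hA0, hneg⟩ :=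
    exists_reg335_bondPair_deltaAOf_neg_cube τ hτt hτs hτp ΛbP ops₀ hd2 hL M i hρ hΩ m hc
  have hcon := hpos (a₃ / M) U₀ hU₀ hα hMα hreg A (B9Eq327GreenZdHerm.domSubH_le (i.Ω 0) hA) hA0
  rw [deltaAOf_withGopZdH] at hcon
  linarith

end Cube

end Literature.MathematicalPhysics.QuantumFieldTheory.Balaban1983to89.B9Thm311IndefiniteInFrameClassCubeZd

end
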